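import Mathlib
import HarnessLib
import Literature.Dynamics.Hyperbolic.RGFlowStableManifoldSecondFixedPointLipschitz

/-!
# The second fixed point of the fine tuning ([ABKM19] Lemma 12.6), V: BOUNDED MIXED SECOND
# DIFFERENCES of the tuned initial relevant coordinate `h⋆` and of the tuned trajectory in the
# initial activity (the `C^{1,1}` half of the regular dependence of `ℋ(𝒦)` on `𝒦`, difference form)

Continuation of `RGFlowStableManifoldSecondFixedPointLipschitz.lean`.  There: two fixed points of
Lemma 12.6 whose initial-activity maps differ by `m_p` are `2m_p/(1−κ)`-close, and so are their tuned
trajectories (weighted).  Here: FOUR fixed points `h_{ij}`, `i, j ∈ {0,1}` (`Bool × Bool`), belonging to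
four initial-activity maps `y₀^{ij}` — think of `y₀^{ij} = K̂_0(𝒦 + iU + jV, ·)` for two increments `U, V` of
the perturbation — with first differences of size `μ₁` (direction `i`), `μ₂` (direction `j`) and JOINT
parallelogram second differences in (parameter, `h`) of size `m₀₀(δ₁ + ‖y‖)(δ₂ + ‖z‖)`; the steps
`(A^h, B^h, S^h)` are Lipschitz in `h` (`a₀, b₀, l₀`, small as in (12.54)–(12.56)) AND have parallelogram
second differences in `h` (`a₀₀, b₀₀, l₀₀`), Lipschitz difference maps (`l₀'`) and parallelogram second
differences in the state (`σ₂`).  Then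

* **`RGFlow.secondDiff_initial_le_of_isTunedQ`** — the mixed second difference of the fixed points,
  `‖h_{11} − h_{10} − h_{01} + h_{00}‖`, is at most `2·Rest/(1−κ)`, and the mixed second differences of the
  four tuned trajectories (both coordinates, scale `k`) are at most `(2·Rest/(1−κ)) η^k`, where
  `Rest = secondPertSize …` is the second-order size built from the first-difference bounds
  `T_i = 2μ_i/(1−κ)` — BILINEAR in `(δ₁ + T₁, δ₂ + T₂)` (`secondPertSize_bilinear`).

Proof: the four tuned trajectories are those of the four systems `(A^{h_{ij}}, B^{h_{ij}}, S^{h_{ij}},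
y₀^{ij}(h_{ij}))`; `secondDiff_le_of_isTunedQ` bounds their mixed second difference — in particular at
scale `0`, where it IS `w = Σ± h_{ij}` — by `Δ₂/(1−κ)`, the data second differences over the
(non-parallelogram) quadrilateral `h_{ij}` being split at the auxiliary vertex `h_{10} + h_{01} − h_{00}`
into a parallelogram part and a Lipschitz part of size `∝ ‖w‖`; the `‖w‖`-terms of `Δ₂` carry exactly
the small constant of (12.54)–(12.56) (`secondPertSize_split`), so they are absorbed: `‖w‖ ≤ ‖w‖/2 +
Rest/(1−κ)`.  Everything is proved; no named fact.

## References
* S. Adams, S. Buchholz, R. Kotecký, S. Müller, arXiv:1910.13564, Lemma 12.6 (12.50)–(12.56),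
  Theorem 12.1, Theorem 2.2 [AdamsBuchholzKoteckyMuller2019].
-/

noncomputable section

open Set Function Metric Filter
open scoped NNReal Topology

namespace Literature.Dynamics.Hyperbolic

namespace RGFlow

variable {E : ℕ → Type*} [∀ k, NormedAddCommGroup (E k)] [∀ k, NormedSpace ℝ (E k)]
  {F : ℕ → Type*} [∀ k, AddCommGroup (F k)]

/-! ## §14 Algebra of the second-order size: splitting off the terms of the unknown -/

/-- **Splitting the second-order size**: if the second-difference sizes of the data carry a part
proportional to an unknown `W ≥ 0` — `a₁₂ = a₀W + A'`, `b₁₂ = b₀W + B'`, `l₁₂ = l₀W + L'`, `m₁₂ = m₀W + M'` —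
then `Δ₂ ≤ W · max m₀ (max (l₀ε/η) ((αb₀ + (η+β)a₀)ε)) + Δ₂'`, `Δ₂'` the size without these parts; the
coefficient of `W` is the small constant of (12.54)–(12.56).
[cite: AdamsBuchholzKoteckyMuller2019, Lemma 12.6 (12.54)–(12.56)] -/
theorem secondPertSize_split {α β η ε σ₂ a₁ a₂ b₁ b₂ l₁' l₂' D₁ D₂ a₀ b₀ l₀ m₀ A' B' L' M' W : ℝ}
    (hW : 0 ≤ W) :
    secondPertSize α β η ε σ₂ a₁ a₂ (a₀ * W + A') b₁ b₂ (b₀ * W + B') l₁' l₂' (l₀ * W + L') (m₀ * W + M') D₁ D₂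
      ≤ W * max m₀ (max (l₀ * ε / η) ((α * b₀ + (η + β) * a₀) * ε))
        + secondPertSize α β η ε σ₂ a₁ a₂ A' b₁ b₂ B' l₁' l₂' L' M' D₁ D₂ := by
  unfold secondPertSize
  set Mx := max m₀ (max (l₀ * ε / η) ((α * b₀ + (η + β) * a₀) * ε)) with hMx
  set R := max M' (max ((σ₂ * D₁ * D₂ + l₁' * D₂ + l₂' * D₁ + L' * ε) / η)
    (α * (b₁ * D₂ + b₂ * D₁ + B' * ε) + (η + β) * (a₁ * D₂ + a₂ * D₁ + A' * ε) + (a₁ * b₂ + a₂ * b₁) * ε))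
    with hR
  have hm₀ : m₀ ≤ Mx := le_max_left _ _
  have hl₀ : l₀ * ε / η ≤ Mx := le_trans (le_max_left _ _) (le_max_right _ _)
  have hab : (α * b₀ + (η + β) * a₀) * ε ≤ Mx := le_trans (le_max_right _ _) (le_max_right _ _)
  have hR1 : M' ≤ R := le_max_left _ _
  have hR2 : (σ₂ * D₁ * D₂ + l₁' * D₂ + l₂' * D₁ + L' * ε) / η ≤ R :=
    le_trans (le_max_left _ _) (le_max_right _ _)
  have hR3 : α * (b₁ * D₂ + b₂ * D₁ + B' * ε) + (η + β) * (a₁ * D₂ + a₂ * D₁ + A' * ε) + (a₁ * b₂ + a₂ * b₁) * ε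
      ≤ R := le_trans (le_max_right _ _) (le_max_right _ _)
  refine max_le ?_ (max_le ?_ ?_)
  · have e : m₀ * W + M' = W * m₀ + M' := by ring
    rw [e]
    exact add_le_add (mul_le_mul_of_nonneg_left hm₀ hW) hR1
  · have e : (σ₂ * D₁ * D₂ + l₁' * D₂ + l₂' * D₁ + (l₀ * W + L') * ε) / η
        = W * (l₀ * ε / η) + (σ₂ * D₁ * D₂ + l₁' * D₂ + l₂' * D₁ + L' * ε) / η := by ring
    rw [e]
    exact add_le_add (mul_le_mul_of_nonneg_left hl₀ hW) hR2
  · have e : α * (b₁ * D₂ + b₂ * D₁ + (b₀ * W + B') * ε) + (η + β) * (a₁ * D₂ + a₂ * D₁ + (a₀ * W + A') * ε)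
          + (a₁ * b₂ + a₂ * b₁) * ε
        = W * ((α * b₀ + (η + β) * a₀) * ε) + (α * (b₁ * D₂ + b₂ * D₁ + B' * ε)
          + (η + β) * (a₁ * D₂ + a₂ * D₁ + A' * ε) + (a₁ * b₂ + a₂ * b₁) * ε) := by ring
    rw [e]
    exact add_le_add (mul_le_mul_of_nonneg_left hab hW) hR3

/-! ## §15 Mixed second differences of four fixed points of Lemma 12.6 -/

section secondOrderFixedPoints

variable {N : ℕ} {r α β σ η κ ε ρ a₀ b₀ l₀ m₀ a₀₀ b₀₀ l₀₀ l₀' σ₂ m₀₀ μ₁ μ₂ δ₁ δ₂ : ℝ}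
  {Q : ∀ k, F k → ℝ → Prop}
  {A : E 0 → ∀ k, E k ≃L[ℝ] E (k + 1)} {B : E 0 → ∀ k, F k →+ E (k + 1)}
  {S : E 0 → ∀ k, E k → F k → F (k + 1)} {y₀ : Bool → Bool → E 0 → F 0}
  {h : Bool → Bool → E 0} {x : Bool → Bool → ∀ k, E k}

/-- **Bounded mixed second differences of the second fixed point and of the tuned trajectory in the
initial activity** ([ABKM19] Lemma 12.6 with Theorem 12.1, smoothness content, difference form).
Steps `(A^h, B^h, S^h)`, `‖h‖ ≤ ρ`: `IsRGStepQ N r α β σ Q`; Lipschitz in `h` with `a₀, b₀, l₀` and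
parallelogram second differences in `h` with `a₀₀, b₀₀, l₀₀`; difference maps `S^{h'} − S^h` are
`l₀'‖h'−h‖`-Lipschitz in the state; each `S^h` has parallelogram second differences `σ₂` in the state.
Four initial-activity maps `y₀^{ij}`, each `m₀`-Lipschitz in `h`, with first differences `μ₁` (in `i`),
`μ₂` (in `j`) and joint second differences `m₀₀(δ₁+‖y‖)(δ₂+‖z‖)`.  Smallness
`max(m₀, l₀ε/η, (αb₀ + a₀(η+β+2ρb₀))ε) ≤ (1−κ)/2`, `3ε ≤ r`, `3ε ≤ ρ`; predicates subadditive, closed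
from above and with nonnegative bounds.  If `x^{ij}` is a tuned trajectory of system
`(A^{h_{ij}}, B^{h_{ij}}, S^{h_{ij}}, y₀^{ij}(h_{ij}))` in the `ε`-tube with `x^{ij}(0) = h_{ij}` for each `i, j`, then with
`T_i = 2μ_i/(1−κ)` and `Rest = secondPertSize α β η ε σ₂ (a₀T₁) (a₀T₂) (a₀₀T₁T₂) (b₀T₁) (b₀T₂) (b₀₀T₁T₂)
(l₀'T₁) (l₀'T₂) (l₀₀T₁T₂) (m₀₀(δ₁+T₁)(δ₂+T₂)) T₁ T₂`:
`‖h_{11} − h_{10} − h_{01} + h_{00}‖ ≤ 2·Rest/(1−κ)`, and for every `k ≤ N` the mixed second differences of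
the relevant and (in `Q`-form) irrelevant coordinates of the four trajectories are `≤ (2·Rest/(1−κ)) η^k`.
[cite: AdamsBuchholzKoteckyMuller2019, Lemma 12.6, Theorem 12.1] -/
theorem secondDiff_initial_le_of_isTunedQ (hQ : IsSubaddNormBound Q)
    (hQc : ∀ k (y : F k) (c : ℝ), (∀ c', c < c' → Q k y c') → Q k y c)
    (hQnn : ∀ k (y : F k) (c : ℝ), Q k y c → 0 ≤ c)
    (hT : ∀ h₀ : E 0, ‖h₀‖ ≤ ρ → IsRGStepQ N r α β σ Q (A h₀) (B h₀) (S h₀))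
    (hη : 0 < η) (hη1 : η ≤ 1) (hα : 0 ≤ α) (hβ : 0 ≤ β) (hκ₁ : α * (η + β) ≤ κ) (hκ₂ : σ ≤ κ * η)
    (hκ : κ < 1) (hε : 0 ≤ ε) (hεr : 3 * ε ≤ r) (hερ : 3 * ε ≤ ρ)
    (ha0 : 0 ≤ a₀) (hb0 : 0 ≤ b₀) (hl0 : 0 ≤ l₀) (hm0 : 0 ≤ m₀) (ha00 : 0 ≤ a₀₀) (hb00 : 0 ≤ b₀₀)
    (hl00 : 0 ≤ l₀₀) (hl0' : 0 ≤ l₀') (hσ₂0 : 0 ≤ σ₂) (hm00 : 0 ≤ m₀₀) (hμ₁ : 0 ≤ μ₁) (hμ₂ : 0 ≤ μ₂)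
    (hδ₁ : 0 ≤ δ₁) (hδ₂ : 0 ≤ δ₂)
    (ha : ∀ h₀ h₀' : E 0, ‖h₀‖ ≤ ρ → ‖h₀'‖ ≤ ρ → ∀ k, k < N → ∀ w : E (k + 1),
      ‖(A h₀ k).symm w - (A h₀' k).symm w‖ ≤ a₀ * ‖h₀ - h₀'‖ * ‖w‖)
    (hb : ∀ h₀ h₀' : E 0, ‖h₀‖ ≤ ρ → ‖h₀'‖ ≤ ρ → ∀ k, k < N → ∀ (v : F k) (c : ℝ), Q k v c →
      ‖B h₀ k v - B h₀' k v‖ ≤ b₀ * ‖h₀ - h₀'‖ * c)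
    (hl : ∀ h₀ h₀' : E 0, ‖h₀‖ ≤ ρ → ‖h₀'‖ ≤ ρ → ∀ k, k < N → ∀ (u : E k) (v : F k) (c : ℝ),
      ‖u‖ ≤ r → Q k v c → c ≤ r →
        Q (k + 1) (S h₀ k u v - S h₀' k u v) (l₀ * ‖h₀ - h₀'‖ * max ‖u‖ c))
    (hA2 : ∀ h₀ y z : E 0, ‖h₀‖ ≤ ρ → ‖h₀ + y‖ ≤ ρ → ‖h₀ + z‖ ≤ ρ → ‖h₀ + y + z‖ ≤ ρ →
      ∀ k, k < N → ∀ w : E (k + 1),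
        ‖(A (h₀ + y + z) k).symm w - (A (h₀ + y) k).symm w - (A (h₀ + z) k).symm w + (A h₀ k).symm w‖
          ≤ a₀₀ * ‖y‖ * ‖z‖ * ‖w‖)
    (hB2 : ∀ h₀ y z : E 0, ‖h₀‖ ≤ ρ → ‖h₀ + y‖ ≤ ρ → ‖h₀ + z‖ ≤ ρ → ‖h₀ + y + z‖ ≤ ρ →
      ∀ k, k < N → ∀ (v : F k) (c : ℝ), Q k v c →
        ‖B (h₀ + y + z) k v - B (h₀ + y) k v - B (h₀ + z) k v + B h₀ k v‖ ≤ b₀₀ * ‖y‖ * ‖z‖ * c)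
    (hS2 : ∀ h₀ y z : E 0, ‖h₀‖ ≤ ρ → ‖h₀ + y‖ ≤ ρ → ‖h₀ + z‖ ≤ ρ → ‖h₀ + y + z‖ ≤ ρ →
      ∀ k, k < N → ∀ (u : E k) (v : F k) (c : ℝ), ‖u‖ ≤ r → Q k v c → c ≤ r →
        Q (k + 1) (S (h₀ + y + z) k u v - S (h₀ + y) k u v - S (h₀ + z) k u v + S h₀ k u v)
          (l₀₀ * ‖y‖ * ‖z‖ * max ‖u‖ c))
    (hl' : ∀ h₀ h₀' : E 0, ‖h₀‖ ≤ ρ → ‖h₀'‖ ≤ ρ → ∀ k, k < N →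
      ∀ (u u' : E k) (v v' : F k) (cv cv' c : ℝ), ‖u‖ ≤ r → ‖u'‖ ≤ r →
        Q k v cv → cv ≤ r → Q k v' cv' → cv' ≤ r → Q k (v - v') c →
        Q (k + 1) ((S h₀' k u v - S h₀ k u v) - (S h₀' k u' v' - S h₀ k u' v'))
          (l₀' * ‖h₀' - h₀‖ * max ‖u - u'‖ c))
    (hσ2 : ∀ h₀ : E 0, ‖h₀‖ ≤ ρ → ∀ k, k < N →
      ∀ (u y z : E k) (v y' z' : F k) (cv cvy cvz cvyz cy cz : ℝ),
        ‖u‖ ≤ r → ‖u + y‖ ≤ r → ‖u + z‖ ≤ r → ‖u + y + z‖ ≤ r →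
        Q k v cv → cv ≤ r → Q k (v + y') cvy → cvy ≤ r → Q k (v + z') cvz → cvz ≤ r →
        Q k (v + y' + z') cvyz → cvyz ≤ r → Q k y' cy → Q k z' cz →
        Q (k + 1) (S h₀ k (u + y + z) (v + y' + z') - S h₀ k (u + y) (v + y')
            - S h₀ k (u + z) (v + z') + S h₀ k u v) (σ₂ * max ‖y‖ cy * max ‖z‖ cz))
    (hm : ∀ i j, ∀ h₀ h₀' : E 0, ‖h₀‖ ≤ ρ → ‖h₀'‖ ≤ ρ →
      Q 0 (y₀ i j h₀ - y₀ i j h₀') (m₀ * ‖h₀ - h₀'‖))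
    (hμ1 : ∀ j, ∀ h₀ : E 0, ‖h₀‖ ≤ ρ → Q 0 (y₀ true j h₀ - y₀ false j h₀) μ₁)
    (hμ2 : ∀ i, ∀ h₀ : E 0, ‖h₀‖ ≤ ρ → Q 0 (y₀ i true h₀ - y₀ i false h₀) μ₂)
    (hμ12 : ∀ h₀ y z : E 0, ‖h₀‖ ≤ ρ → ‖h₀ + y‖ ≤ ρ → ‖h₀ + z‖ ≤ ρ → ‖h₀ + y + z‖ ≤ ρ →
      Q 0 (y₀ true true (h₀ + y + z) - y₀ true false (h₀ + y) - y₀ false true (h₀ + z) + y₀ false false h₀)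
        (m₀₀ * (δ₁ + ‖y‖) * (δ₂ + ‖z‖)))
    (hsmall : max m₀ (max (l₀ * ε / η) ((α * b₀ + a₀ * (η + β + 2 * ρ * b₀)) * ε)) ≤ (1 - κ) / 2)
    (htr : ∀ i j, IsTunedQ N (A (h i j)) (B (h i j)) (S (h i j)) (y₀ i j (h i j)) (x i j))
    (htu : ∀ i j, InTubeQ N η ε Q (S (h i j)) (y₀ i j (h i j)) (x i j))
    (hx : ∀ i j, x i j 0 = h i j) :
    ‖h true true - h true false - h false true + h false false‖
        ≤ 2 * secondPertSize α β η ε σ₂ (a₀ * (2 * μ₁ / (1 - κ))) (a₀ * (2 * μ₂ / (1 - κ)))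
            (a₀₀ * (2 * μ₁ / (1 - κ)) * (2 * μ₂ / (1 - κ))) (b₀ * (2 * μ₁ / (1 - κ))) (b₀ * (2 * μ₂ / (1 - κ)))
            (b₀₀ * (2 * μ₁ / (1 - κ)) * (2 * μ₂ / (1 - κ))) (l₀' * (2 * μ₁ / (1 - κ))) (l₀' * (2 * μ₂ / (1 - κ)))
            (l₀₀ * (2 * μ₁ / (1 - κ)) * (2 * μ₂ / (1 - κ)))
            (m₀₀ * (δ₁ + 2 * μ₁ / (1 - κ)) * (δ₂ + 2 * μ₂ / (1 - κ))) (2 * μ₁ / (1 - κ)) (2 * μ₂ / (1 - κ))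
          / (1 - κ) ∧
      ∀ k, k ≤ N →
        ‖x true true k - x true false k - x false true k + x false false k‖
          ≤ 2 * secondPertSize α β η ε σ₂ (a₀ * (2 * μ₁ / (1 - κ))) (a₀ * (2 * μ₂ / (1 - κ)))
              (a₀₀ * (2 * μ₁ / (1 - κ)) * (2 * μ₂ / (1 - κ))) (b₀ * (2 * μ₁ / (1 - κ))) (b₀ * (2 * μ₂ / (1 - κ)))
              (b₀₀ * (2 * μ₁ / (1 - κ)) * (2 * μ₂ / (1 - κ))) (l₀' * (2 * μ₁ / (1 - κ))) (l₀' * (2 * μ₂ / (1 - κ)))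
              (l₀₀ * (2 * μ₁ / (1 - κ)) * (2 * μ₂ / (1 - κ)))
              (m₀₀ * (δ₁ + 2 * μ₁ / (1 - κ)) * (δ₂ + 2 * μ₂ / (1 - κ))) (2 * μ₁ / (1 - κ)) (2 * μ₂ / (1 - κ))
            / (1 - κ) * η ^ k ∧
        Q k (fwd (S (h true true)) (y₀ true true (h true true)) (x true true) k
            - fwd (S (h true false)) (y₀ true false (h true false)) (x true false) k
            - fwd (S (h false true)) (y₀ false true (h false true)) (x false true) k
            + fwd (S (h false false)) (y₀ false false (h false false)) (x false false) k)
          (2 * secondPertSize α β η ε σ₂ (a₀ * (2 * μ₁ / (1 - κ))) (a₀ * (2 * μ₂ / (1 - κ)))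
              (a₀₀ * (2 * μ₁ / (1 - κ)) * (2 * μ₂ / (1 - κ))) (b₀ * (2 * μ₁ / (1 - κ))) (b₀ * (2 * μ₂ / (1 - κ)))
              (b₀₀ * (2 * μ₁ / (1 - κ)) * (2 * μ₂ / (1 - κ))) (l₀' * (2 * μ₁ / (1 - κ))) (l₀' * (2 * μ₂ / (1 - κ)))
              (l₀₀ * (2 * μ₁ / (1 - κ)) * (2 * μ₂ / (1 - κ)))
              (m₀₀ * (δ₁ + 2 * μ₁ / (1 - κ)) * (δ₂ + 2 * μ₂ / (1 - κ))) (2 * μ₁ / (1 - κ)) (2 * μ₂ / (1 - κ))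
            / (1 - κ) * η ^ k) := by
  have h1κ : 0 < 1 - κ := by linarith
  have hερ' : ε ≤ ρ := by linarith
  have hεr' : ε ≤ r := by linarith
  have hρ : 0 ≤ ρ := by linarith
  -- the fixed points lie in the `ε`-ball
  have hhε : ∀ i j, ‖h i j‖ ≤ ε := fun i j => by
    have h0 := (htu i j 0 (Nat.zero_le _)).1
    rw [pow_zero, mul_one, hx i j] at h0
    exact h0
  have hhρ : ∀ i j, ‖h i j‖ ≤ ρ := fun i j => (hhε i j).trans hερ'
  set T₁ := 2 * μ₁ / (1 - κ) with hT₁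
  set T₂ := 2 * μ₂ / (1 - κ) with hT₂
  have hT₁0 : 0 ≤ T₁ := div_nonneg (by linarith) h1κ.le
  have hT₂0 : 0 ≤ T₂ := div_nonneg (by linarith) h1κ.le
  -- first differences of the fixed points (§13)
  have hd₁ : ∀ j, ‖h true j - h false j‖ ≤ T₁ := fun j =>
    norm_initial_sub_le_of_isTunedQ (y₀ := y₀ true j) (y₀' := y₀ false j) hQ hT hη hη1 hα hβ hκ₁ hκ₂ hκ hε
      hεr' hερ' ha0 hb0 hl0 hμ₁ ha hb hl (hm true j) (hμ1 j) hsmall (htr true j) (htu true j) (hx true j)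
      (htr false j) (htu false j) (hx false j)
  have hd₂ : ∀ i, ‖h i true - h i false‖ ≤ T₂ := fun i =>
    norm_initial_sub_le_of_isTunedQ (y₀ := y₀ i true) (y₀' := y₀ i false) hQ hT hη hη1 hα hβ hκ₁ hκ₂ hκ hε
      hεr' hερ' ha0 hb0 hl0 hμ₂ ha hb hl (hm i true) (hμ2 i) hsmall (htr i true) (htu i true) (hx i true)
      (htr i false) (htu i false) (hx i false)
  -- first differences of the tuned trajectories (§13)
  have hD₁ : ∀ j k, k ≤ N → ‖x true j k - x false j k‖ ≤ T₁ * η ^ k ∧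
      Q k (fwd (S (h true j)) (y₀ true j (h true j)) (x true j) k
        - fwd (S (h false j)) (y₀ false j (h false j)) (x false j) k) (T₁ * η ^ k) := fun j =>
    dist_traj_le_of_isTunedQ_initial (y₀ := y₀ true j) (y₀' := y₀ false j) hQ hQc hT hη hη1 hα hβ hκ₁ hκ₂
      hκ hε hεr' hερ' ha0 hb0 hl0 hμ₁ ha hb hl (hm true j) (hμ1 j) hsmall (htr true j) (htu true j)
      (hx true j) (htr false j) (htu false j) (hx false j)
  have hD₂ : ∀ i k, k ≤ N → ‖x i true k - x i false k‖ ≤ T₂ * η ^ k ∧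
      Q k (fwd (S (h i true)) (y₀ i true (h i true)) (x i true) k
        - fwd (S (h i false)) (y₀ i false (h i false)) (x i false) k) (T₂ * η ^ k) := fun i =>
    dist_traj_le_of_isTunedQ_initial (y₀ := y₀ i true) (y₀' := y₀ i false) hQ hQc hT hη hη1 hα hβ hκ₁ hκ₂
      hκ hε hεr' hερ' ha0 hb0 hl0 hμ₂ ha hb hl (hm i true) (hμ2 i) hsmall (htr i true) (htu i true)
      (hx i true) (htr i false) (htu i false) (hx i false)
  -- the unknown and the auxiliary vertex `h♯ = h₁₀ + h₀₁ − h₀₀`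
  set w₀ := h true true - h true false - h false true + h false false with hw₀
  have e1 : h false false + (h true false - h false false) = h true false := by abel
  have e2 : h false false + (h false true - h false false) = h false true := by abel
  have e3 : h true false + (h false true - h false false) = h true false + h false true - h false false := by
    abel
  have e4 : h true true - (h true false + h false true - h false false) = w₀ := by rw [hw₀]; abel
  have hy : ‖h true false - h false false‖ ≤ T₁ := hd₁ false
  have hz : ‖h false true - h false false‖ ≤ T₂ := hd₂ false
  have hyz : ‖h true false - h false false‖ * ‖h false true - h false false‖ ≤ T₁ * T₂ :=
    mul_le_mul hy hz (norm_nonneg _) hT₁0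
  have hsharp : ‖h true false + h false true - h false false‖ ≤ ρ := by
    calc ‖h true false + h false true - h false false‖
        ≤ ‖h true false + h false true‖ + ‖h false false‖ := norm_sub_le _ _
      _ ≤ ‖h true false‖ + ‖h false true‖ + ‖h false false‖ := add_le_add (norm_add_le _ _) le_rfl
      _ ≤ ε + ε + ε := by gcongr <;> exact hhε _ _
      _ = 3 * ε := by ring
      _ ≤ ρ := hερ
  have hp2 : ‖h false false + (h true false - h false false)‖ ≤ ρ := by rw [e1]; exact hhρ _ _
  have hp3 : ‖h false false + (h false true - h false false)‖ ≤ ρ := by rw [e2]; exact hhρ _ _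
  have hp4 : ‖h false false + (h true false - h false false) + (h false true - h false false)‖ ≤ ρ := by
    rw [e1, e3]; exact hsharp
  -- the parallelogram hypotheses at `h₀₀` with `y = h₁₀ − h₀₀`, `z = h₀₁ − h₀₀`
  have hA2' := hA2 (h false false) (h true false - h false false) (h false true - h false false)
    (hhρ _ _) hp2 hp3 hp4
  have hB2' := hB2 (h false false) (h true false - h false false) (h false true - h false false)
    (hhρ _ _) hp2 hp3 hp4
  have hS2' := hS2 (h false false) (h true false - h false false) (h false true - h false false)
    (hhρ _ _) hp2 hp3 hp4
  have hμ12' := hμ12 (h false false) (h true false - h false false) (h false true - h false false)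
    (hhρ _ _) hp2 hp3 hp4
  rw [e1, e2, e3] at hA2' hB2' hS2' hμ12'
  -- the second-difference data of the four systems
  have ha₁ : ∀ j k, k < N → ∀ w : E (k + 1),
      ‖(A (h true j) k).symm w - (A (h false j) k).symm w‖ ≤ a₀ * T₁ * ‖w‖ := by
    intro j k hk w
    refine (ha _ _ (hhρ _ _) (hhρ _ _) k hk w).trans ?_
    exact mul_le_mul_of_nonneg_right (mul_le_mul_of_nonneg_left (hd₁ j) ha0) (norm_nonneg _)
  have ha₂ : ∀ i k, k < N → ∀ w : E (k + 1),
      ‖(A (h i true) k).symm w - (A (h i false) k).symm w‖ ≤ a₀ * T₂ * ‖w‖ := by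
    intro i k hk w
    refine (ha _ _ (hhρ _ _) (hhρ _ _) k hk w).trans ?_
    exact mul_le_mul_of_nonneg_right (mul_le_mul_of_nonneg_left (hd₂ i) ha0) (norm_nonneg _)
  have ha₁₂ : ∀ k, k < N → ∀ w : E (k + 1),
      ‖(A (h true true) k).symm w - (A (h true false) k).symm w - (A (h false true) k).symm w
          + (A (h false false) k).symm w‖ ≤ (a₀ * ‖w₀‖ + a₀₀ * T₁ * T₂) * ‖w‖ := by
    intro k hk w
    have h1 := ha (h true true) (h true false + h false true - h false false) (hhρ _ _) hsharp k hk w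
    rw [e4] at h1
    have h2 := (hA2' k hk w).trans (mul_le_mul_of_nonneg_right
      (by calc a₀₀ * ‖h true false - h false false‖ * ‖h false true - h false false‖
            = a₀₀ * (‖h true false - h false false‖ * ‖h false true - h false false‖) := by ring
          _ ≤ a₀₀ * (T₁ * T₂) := mul_le_mul_of_nonneg_left hyz ha00
          _ = a₀₀ * T₁ * T₂ := by ring) (norm_nonneg w))
    have e : (A (h true true) k).symm w - (A (h true false) k).symm w - (A (h false true) k).symm w
          + (A (h false false) k).symm w
        = ((A (h true true) k).symm w - (A (h true false + h false true - h false false) k).symm w)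
          + ((A (h true false + h false true - h false false) k).symm w - (A (h true false) k).symm w
              - (A (h false true) k).symm w + (A (h false false) k).symm w) := by abel
    rw [e]
    refine (norm_add_le _ _).trans ?_
    calc _ ≤ a₀ * ‖w₀‖ * ‖w‖ + a₀₀ * T₁ * T₂ * ‖w‖ := add_le_add h1 h2
      _ = (a₀ * ‖w₀‖ + a₀₀ * T₁ * T₂) * ‖w‖ := by ring
  have hb₁ : ∀ j k, k < N → ∀ (v : F k) (c : ℝ), Q k v c →
      ‖B (h true j) k v - B (h false j) k v‖ ≤ b₀ * T₁ * c := by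
    intro j k hk v c hv
    refine (hb _ _ (hhρ _ _) (hhρ _ _) k hk v c hv).trans ?_
    exact mul_le_mul_of_nonneg_right (mul_le_mul_of_nonneg_left (hd₁ j) hb0) (hQnn k v c hv)
  have hb₂ : ∀ i k, k < N → ∀ (v : F k) (c : ℝ), Q k v c →
      ‖B (h i true) k v - B (h i false) k v‖ ≤ b₀ * T₂ * c := by
    intro i k hk v c hv
    refine (hb _ _ (hhρ _ _) (hhρ _ _) k hk v c hv).trans ?_
    exact mul_le_mul_of_nonneg_right (mul_le_mul_of_nonneg_left (hd₂ i) hb0) (hQnn k v c hv)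
  have hb₁₂ : ∀ k, k < N → ∀ (v : F k) (c : ℝ), Q k v c →
      ‖B (h true true) k v - B (h true false) k v - B (h false true) k v + B (h false false) k v‖
        ≤ (b₀ * ‖w₀‖ + b₀₀ * T₁ * T₂) * c := by
    intro k hk v c hv
    have hc : 0 ≤ c := hQnn k v c hv
    have h1 := hb (h true true) (h true false + h false true - h false false) (hhρ _ _) hsharp k hk v c hv
    rw [e4] at h1
    have h2 := (hB2' k hk v c hv).trans (mul_le_mul_of_nonneg_right
      (by calc b₀₀ * ‖h true false - h false false‖ * ‖h false true - h false false‖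
            = b₀₀ * (‖h true false - h false false‖ * ‖h false true - h false false‖) := by ring
          _ ≤ b₀₀ * (T₁ * T₂) := mul_le_mul_of_nonneg_left hyz hb00
          _ = b₀₀ * T₁ * T₂ := by ring) hc)
    have e : B (h true true) k v - B (h true false) k v - B (h false true) k v + B (h false false) k v
        = (B (h true true) k v - B (h true false + h false true - h false false) k v)
          + (B (h true false + h false true - h false false) k v - B (h true false) k v
              - B (h false true) k v + B (h false false) k v) := by abel
    rw [e]
    refine (norm_add_le _ _).trans ?_
    calc _ ≤ b₀ * ‖w₀‖ * c + b₀₀ * T₁ * T₂ * c := add_le_add h1 h2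
      _ = (b₀ * ‖w₀‖ + b₀₀ * T₁ * T₂) * c := by ring
  have hl₁ : ∀ k, k < N → ∀ (u u' : E k) (v v' : F k) (cv cv' c : ℝ), ‖u‖ ≤ r → ‖u'‖ ≤ r →
      Q k v cv → cv ≤ r → Q k v' cv' → cv' ≤ r → Q k (v - v') c →
      Q (k + 1) ((S (h true false) k u v - S (h false false) k u v)
          - (S (h true false) k u' v' - S (h false false) k u' v')) (l₀' * T₁ * max ‖u - u'‖ c) := by
    intro k hk u u' v v' cv cv' c hu hu' hv hcv hv' hcv' hvv'
    refine hQ.mono _ _ _ _ (hl' _ _ (hhρ _ _) (hhρ _ _) k hk u u' v v' cv cv' c hu hu' hv hcv hv' hcv' hvv') ?_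
    exact mul_le_mul_of_nonneg_right (mul_le_mul_of_nonneg_left hy hl0')
      (le_max_of_le_left (norm_nonneg _))
  have hl₂ : ∀ k, k < N → ∀ (u u' : E k) (v v' : F k) (cv cv' c : ℝ), ‖u‖ ≤ r → ‖u'‖ ≤ r →
      Q k v cv → cv ≤ r → Q k v' cv' → cv' ≤ r → Q k (v - v') c →
      Q (k + 1) ((S (h false true) k u v - S (h false false) k u v)
          - (S (h false true) k u' v' - S (h false false) k u' v')) (l₀' * T₂ * max ‖u - u'‖ c) := by
    intro k hk u u' v v' cv cv' c hu hu' hv hcv hv' hcv' hvv'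
    refine hQ.mono _ _ _ _ (hl' _ _ (hhρ _ _) (hhρ _ _) k hk u u' v v' cv cv' c hu hu' hv hcv hv' hcv' hvv') ?_
    exact mul_le_mul_of_nonneg_right (mul_le_mul_of_nonneg_left hz hl0')
      (le_max_of_le_left (norm_nonneg _))
  have hl₁₂ : ∀ k, k < N → ∀ (u : E k) (v : F k) (cv : ℝ), ‖u‖ ≤ r → Q k v cv → cv ≤ r →
      Q (k + 1) (S (h true true) k u v - S (h true false) k u v - S (h false true) k u v + S (h false false) k u v)
        ((l₀ * ‖w₀‖ + l₀₀ * T₁ * T₂) * max ‖u‖ cv) := by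
    intro k hk u v cv hu hv hcv
    have hmax : 0 ≤ max ‖u‖ cv := le_max_of_le_left (norm_nonneg _)
    have h1 := hl (h true true) (h true false + h false true - h false false) (hhρ _ _) hsharp k hk u v cv
      hu hv hcv
    rw [e4] at h1
    have h2 := hS2' k hk u v cv hu hv hcv
    have h12 := hQ.add _ _ _ _ _ h1 h2
    have e : (S (h true true) k u v - S (h true false + h false true - h false false) k u v)
          + (S (h true false + h false true - h false false) k u v - S (h true false) k u v
              - S (h false true) k u v + S (h false false) k u v)
        = S (h true true) k u v - S (h true false) k u v - S (h false true) k u v + S (h false false) k u v := by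
      abel
    rw [e] at h12
    refine hQ.mono _ _ _ _ h12 ?_
    have h3 : l₀₀ * ‖h true false - h false false‖ * ‖h false true - h false false‖ ≤ l₀₀ * T₁ * T₂ := by
      calc l₀₀ * ‖h true false - h false false‖ * ‖h false true - h false false‖
          = l₀₀ * (‖h true false - h false false‖ * ‖h false true - h false false‖) := by ring
        _ ≤ l₀₀ * (T₁ * T₂) := mul_le_mul_of_nonneg_left hyz hl00
        _ = l₀₀ * T₁ * T₂ := by ring
    calc l₀ * ‖w₀‖ * max ‖u‖ cv + l₀₀ * ‖h true false - h false false‖ * ‖h false true - h false false‖ * max ‖u‖ cv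
        ≤ l₀ * ‖w₀‖ * max ‖u‖ cv + l₀₀ * T₁ * T₂ * max ‖u‖ cv :=
          add_le_add le_rfl (mul_le_mul_of_nonneg_right h3 hmax)
      _ = (l₀ * ‖w₀‖ + l₀₀ * T₁ * T₂) * max ‖u‖ cv := by ring
  have hm₁₂ : Q 0 (y₀ true true (h true true) - y₀ true false (h true false) - y₀ false true (h false true)
        + y₀ false false (h false false)) (m₀ * ‖w₀‖ + m₀₀ * (δ₁ + T₁) * (δ₂ + T₂)) := by
    have h1 := hm true true (h true true) (h true false + h false true - h false false) (hhρ _ _) hsharp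
    rw [e4] at h1
    have h12 := hQ.add _ _ _ _ _ h1 hμ12'
    have e : (y₀ true true (h true true) - y₀ true true (h true false + h false true - h false false))
          + (y₀ true true (h true false + h false true - h false false) - y₀ true false (h true false)
              - y₀ false true (h false true) + y₀ false false (h false false))
        = y₀ true true (h true true) - y₀ true false (h true false) - y₀ false true (h false true)
          + y₀ false false (h false false) := by abel
    rw [e] at h12
    refine hQ.mono _ _ _ _ h12 (add_le_add le_rfl ?_)
    have h3 : δ₁ + ‖h true false - h false false‖ ≤ δ₁ + T₁ := add_le_add le_rfl hy
    have h4 : δ₂ + ‖h false true - h false false‖ ≤ δ₂ + T₂ := add_le_add le_rfl hz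
    calc m₀₀ * (δ₁ + ‖h true false - h false false‖) * (δ₂ + ‖h false true - h false false‖)
        = m₀₀ * ((δ₁ + ‖h true false - h false false‖) * (δ₂ + ‖h false true - h false false‖)) := by ring
      _ ≤ m₀₀ * ((δ₁ + T₁) * (δ₂ + T₂)) :=
          mul_le_mul_of_nonneg_left (mul_le_mul h3 h4 (by positivity) (by positivity)) hm00
      _ = m₀₀ * (δ₁ + T₁) * (δ₂ + T₂) := by ring
  have hσ₂' : ∀ k, k < N → ∀ (u y z : E k) (v y' z' : F k) (cv cvy cvz cvyz cy cz : ℝ),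
      ‖u‖ ≤ r → ‖u + y‖ ≤ r → ‖u + z‖ ≤ r → ‖u + y + z‖ ≤ r →
      Q k v cv → cv ≤ r → Q k (v + y') cvy → cvy ≤ r → Q k (v + z') cvz → cvz ≤ r →
      Q k (v + y' + z') cvyz → cvyz ≤ r → Q k y' cy → Q k z' cz →
      Q (k + 1) (S (h false false) k (u + y + z) (v + y' + z') - S (h false false) k (u + y) (v + y')
          - S (h false false) k (u + z) (v + z') + S (h false false) k u v) (σ₂ * max ‖y‖ cy * max ‖z‖ cz) :=
    hσ2 (h false false) (hhρ _ _)
  -- nonnegativity of the full second-order size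
  have hm₁₂0 : 0 ≤ m₀ * ‖w₀‖ + m₀₀ * (δ₁ + T₁) * (δ₂ + T₂) := by positivity
  have hΔ0 : 0 ≤ secondPertSize α β η ε σ₂ (a₀ * T₁) (a₀ * T₂) (a₀ * ‖w₀‖ + a₀₀ * T₁ * T₂) (b₀ * T₁) (b₀ * T₂)
      (b₀ * ‖w₀‖ + b₀₀ * T₁ * T₂) (l₀' * T₁) (l₀' * T₂) (l₀ * ‖w₀‖ + l₀₀ * T₁ * T₂)
      (m₀ * ‖w₀‖ + m₀₀ * (δ₁ + T₁) * (δ₂ + T₂)) T₁ T₂ := by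
    unfold secondPertSize
    exact le_trans hm₁₂0 (le_max_left _ _)
  -- the second-difference theorem for the four systems
  have hmain := secondDiff_le_of_isTunedQ (A := fun i j => A (h i j)) (B := fun i j => B (h i j))
    (S := fun i j => S (h i j)) (y₀ := fun i j => y₀ i j (h i j)) (x := x)
    (a₁ := a₀ * T₁) (a₂ := a₀ * T₂) (a₁₂ := a₀ * ‖w₀‖ + a₀₀ * T₁ * T₂) (b₁ := b₀ * T₁) (b₂ := b₀ * T₂)
    (b₁₂ := b₀ * ‖w₀‖ + b₀₀ * T₁ * T₂) (l₁' := l₀' * T₁) (l₂' := l₀' * T₂) (l₁₂ := l₀ * ‖w₀‖ + l₀₀ * T₁ * T₂)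
    (m₁₂ := m₀ * ‖w₀‖ + m₀₀ * (δ₁ + T₁) * (δ₂ + T₂)) (D₁ := T₁) (D₂ := T₂) (σ₂ := σ₂)
    hQ hQc (fun i j => hT _ (hhρ i j)) hη hη1 hα hβ hκ₁ hκ₂ hκ hε hεr htr htu
    (mul_nonneg ha0 hT₁0) (mul_nonneg ha0 hT₂0) (by positivity) hσ₂0 hT₁0 hT₂0 hΔ0
    ha₁ ha₂ ha₁₂ hb₁ hb₂ hb₁₂ hl₁ hl₂ hl₁₂ hσ₂' hm₁₂ hD₁ hD₂
  -- absorb the `‖w₀‖`-terms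
  set Δfull := secondPertSize α β η ε σ₂ (a₀ * T₁) (a₀ * T₂) (a₀ * ‖w₀‖ + a₀₀ * T₁ * T₂) (b₀ * T₁) (b₀ * T₂)
      (b₀ * ‖w₀‖ + b₀₀ * T₁ * T₂) (l₀' * T₁) (l₀' * T₂) (l₀ * ‖w₀‖ + l₀₀ * T₁ * T₂)
      (m₀ * ‖w₀‖ + m₀₀ * (δ₁ + T₁) * (δ₂ + T₂)) T₁ T₂ with hΔfull
  set Rest := secondPertSize α β η ε σ₂ (a₀ * T₁) (a₀ * T₂) (a₀₀ * T₁ * T₂) (b₀ * T₁) (b₀ * T₂)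
      (b₀₀ * T₁ * T₂) (l₀' * T₁) (l₀' * T₂) (l₀₀ * T₁ * T₂) (m₀₀ * (δ₁ + T₁) * (δ₂ + T₂)) T₁ T₂ with hRest
  have hsplit : Δfull ≤ ‖w₀‖ * max m₀ (max (l₀ * ε / η) ((α * b₀ + (η + β) * a₀) * ε)) + Rest :=
    secondPertSize_split (norm_nonneg w₀)
  have hMx : max m₀ (max (l₀ * ε / η) ((α * b₀ + (η + β) * a₀) * ε)) ≤ (1 - κ) / 2 := by
    refine le_trans (max_le_max le_rfl (max_le_max le_rfl (mul_le_mul_of_nonneg_right ?_ hε))) hsmall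
    have : 0 ≤ a₀ * (2 * ρ * b₀) := by positivity
    nlinarith
  have hw₀le : ‖w₀‖ ≤ Δfull / (1 - κ) := by
    have h0 := (hmain 0 (Nat.zero_le _)).1
    simp only [pow_zero, mul_one, hx] at h0
    exact h0
  have hw₀ : ‖w₀‖ ≤ 2 * Rest / (1 - κ) := by
    have h1 : ‖w₀‖ ≤ (‖w₀‖ * ((1 - κ) / 2) + Rest) / (1 - κ) := by
      refine hw₀le.trans (div_le_div_of_nonneg_right (hsplit.trans ?_) h1κ.le)
      exact add_le_add (mul_le_mul_of_nonneg_left hMx (norm_nonneg _)) le_rfl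
    have e : (‖w₀‖ * ((1 - κ) / 2) + Rest) / (1 - κ) = ‖w₀‖ / 2 + Rest / (1 - κ) := by field_simp
    rw [e] at h1
    have h2 : ‖w₀‖ ≤ 2 * (Rest / (1 - κ)) := by linarith
    calc ‖w₀‖ ≤ 2 * (Rest / (1 - κ)) := h2
      _ = 2 * Rest / (1 - κ) := by ring
  have hΔle : Δfull / (1 - κ) ≤ 2 * Rest / (1 - κ) := by
    refine div_le_div_of_nonneg_right ?_ h1κ.le
    have h1 : ‖w₀‖ * ((1 - κ) / 2) ≤ Rest := by
      have := mul_le_mul_of_nonneg_right hw₀ (show 0 ≤ (1 - κ) / 2 by linarith)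
      refine this.trans (le_of_eq ?_)
      field_simp
    calc Δfull ≤ ‖w₀‖ * ((1 - κ) / 2) + Rest :=
          hsplit.trans (add_le_add (mul_le_mul_of_nonneg_left hMx (norm_nonneg _)) le_rfl)
      _ ≤ Rest + Rest := add_le_add h1 le_rfl
      _ = 2 * Rest := by ring
  refine ⟨hw₀, fun k hk => ?_⟩
  obtain ⟨h1, h2⟩ := hmain k hk
  have hηk : 0 ≤ η ^ k := pow_nonneg hη.le k
  exact ⟨h1.trans (mul_le_mul_of_nonneg_right hΔle hηk), hQ.mono _ _ _ _ h2 (mul_le_mul_of_nonneg_right hΔle hηk)⟩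

end secondOrderFixedPoints

end RGFlow

end Literature.Dynamics.Hyperbolic

end
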